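import Literature.NumberTheory.LFunctions.SuzukiScrewLineProofs
import Literature.NumberTheory.LFunctions.ZetaScrewHermitianFormsProofs
import Literature.NumberTheory.LFunctions.ZetaScrewGrowthMomentsProofs
import Literature.NumberTheory.LFunctions.WeilMellinBounds
import HarnessLib
import Summits.RiemannHypothesis.RiemannHypothesis.Theorems.WeilPositivity

/-!
# The RH-free halves ("doors") of Suzuki's screw-line criteria CJM Thm 4.4 (i) and Cor 4.3 — PROOFS

LINE 1 — LABEL: RH-FREE DOOR THEOREMS about two RH-EQUIVALENT·PRINTED criteria. This proof-only
module (no definition, no named fact) proves the directions "criterion ⟹ RH" of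

* **CJM Cor 4.3** (`Suzuki2025_cor43`): if `(1/2π)‖𝔖_t‖²_{L²(ℝ)} = −g(t)` (4.6) for all `t ≥ t₀`
  (some `t₀ ≥ 0`), then RH — `Suzuki2025_cor43_mpr`;
* **CJM Thm 4.4 (i)** (`Suzuki2025_thm44`): if `‖P̂_φ‖²_{L²(ℝ)} = π⟨φ,φ⟩_{G_g}` (4.7) for every
  `φ ∈ C_c^∞(ℝ)` with `φ̂(0) = 0`, then RH — `Suzuki2025_thm44_mpr`;

and records the resulting REDUCTIONS of the two named facts to their RH-CONSEQUENCE halves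
(`Suzuki2025_cor43_of_thm42`: Cor 4.3 ⟸ Thm 4.2; `Suzuki2025_thm44_of_onlyIf`: Thm 4.4 ⟸ its
clause "RH ⟹ (4.7)"), so that the only undischarged content of either fact is a consequence of
Prop 4.1 (the model-space orthonormal basis under RH — boundary F2 of the cell). bears_on: LADDER-RH
B-C/B-P (COLUMN 6 DBR). WHAT THIS IS NOT: a door is an implication "identity ⟹ RH"; nobody has
shown (4.6) or (4.7); the residual identities are RH-EQUIVALENT as printed; formalising them fixes
WHICH identity would prove RH and does not move RH; nothing here bears on the truth of RH.

Source: M. Suzuki, *On the Hilbert space derived from the Weil distribution*, Canad. J. Math. (2025)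
= arXiv:2301.00421v3 [`Suzuki2025WeilHilbertSpace`], Cor 4.3 (TeX l.1250–1268) and Thm 4.4 with
its proof, §4.3 (TeX l.1274–1345).

## The printed proofs and this formalisation

* Cor 4.3, `⟸` (TeX l.1263–1268): "(4.6) implies that `−g(t)` is nonnegative on `[t₀,∞)` … this
  sufficient condition implies the RH by [Su23, Theorems 1.7 and 11.1]". The tree has exactly this
  input as a THEOREM: `riemannHypothesis_of_zetaScrew_eventually_nonneg` (Suzuki JLMS 2023 Thm 11.1
  at `ω = 0`, `ZetaScrewGrowthMomentsProofs.lean`; `−g = Ψ = zetaScrew`), and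
  `(1/2π)‖𝔖_t‖² ≥ 0` trivially.
* Thm 4.4 (i), `⟸` (TeX l.1303–1345): the source argues by contradiction from a zero `γ₀ ∉ ℝ`
  using [Yoshida 1992, Lemma 1] (Weil's hermitian form is negative at a suitable test function built
  from an off-line zero) and the identity (4.10) `⟨Dψ₁,Dψ₂⟩_{G_g} = ⟨ψ₁,ψ₂⟩_W`
  [Su23, Prop 3.1]. Contrapositively this is: (4.7) on `D(C_c^∞(ℝ))` (every `Dψ`, `ψ ∈ C_c^∞(ℝ)`,
  has `(Dψ)^(0) = 0`) gives `⟨ψ,ψ⟩_W = ⟨Dψ,Dψ⟩_{G_g} = π⁻¹‖P̂_{Dψ}‖² ≥ 0` for all `ψ ∈ C_c^∞(ℝ)`,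
  i.e. Weil positivity, hence RH by Weil's criterion — which is how the tree packages Yoshida's
  Lemma 1 (`weil_criterion_holds : RH ↔ WeilPositivity`, `WeilCriterionProofs.lean`, whose `⟸`
  IS the off-line-zero negativity argument). (4.10) is the tree's THEOREM
  `Suzuki2023_prop31_holds` in its `ℝ²`-window form `weilQuadratic_eq_integral_zetaScrewKernel`
  (`ZetaScrewHermitianFormsProofs.lean`); the factor `i` of `D = i d/dt` (1.8) cancels in the
  hermitian form, so we use `φ = ψ′` (`deriv ψ`) directly.

Nothing else is used; in particular no positivity of `E_ξ`, no Hermite–Biehler property and no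
Hardy-space fact enters (Conrey–Li guard).

## Deliberately NOT here

The `⟹` halves (RH ⟹ (4.6), RH ⟹ (4.7)): they need Thm 4.2 / Prop 4.1 (orthonormal basis
`(F_γ)` of `𝒦(Θ_ξ)` under RH = boundary F2 "model-space heart"); Thm 1.4 `⟸` is
`Suzuki2025_thm14_if` (`SuzukiScrewLineProofs.lean`).
-/

noncomputable section

open MeasureTheory Set Complex
open scoped ComplexConjugate

namespace Literature.NumberTheory.LFunctions

/-! ## Cor 4.3: the door and the reduction to Thm 4.2 -/

/-- RH-FREE DOOR (line 1): **CJM Cor 4.3, `⟸`**. If there is `t₀ ≥ 0` with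
`(1/2π)‖𝔖_t‖²_{L²(ℝ)} = −g(t)` (4.6) for all `t ≥ t₀` (`−g = Ψ = zetaScrew`), then the Riemann
hypothesis holds: (4.6) makes `Ψ ≥ 0` on `[t₀,∞)`, and eventual non-negativity of `Ψ` implies RH
("by [Su23, Theorems 1.7 and 11.1]" = the tree's `riemannHypothesis_of_zetaScrew_eventually_nonneg`).
WHAT THIS IS NOT: nobody has shown (4.6); it is RH-EQUIVALENT (Cor 4.3).
[cite: Suzuki2025WeilHilbertSpace, Cor. 4.3 (⇐), proof TeX l.1263–1268] -/
theorem Suzuki2025_cor43_mpr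
    (h : ∃ t₀ : ℝ, 0 ≤ t₀ ∧ ∀ t : ℝ, t₀ ≤ t →
      1 / (2 * Real.pi) * ∫ x : ℝ, ‖screwLine t x‖ ^ 2 = zetaScrew t) :
    RiemannHypothesis := by
  obtain ⟨t₀, ht₀, hid⟩ := h
  refine riemannHypothesis_of_zetaScrew_eventually_nonneg ⟨t₀ + 1, by linarith, fun t ht ↦ ?_⟩
  rw [← hid t (by linarith)]
  exact mul_nonneg (by positivity) (integral_nonneg fun _ ↦ by positivity)

/-- RH-FREE REDUCTION: **CJM Cor 4.3 holds as soon as CJM Thm 4.2 does** — the named fact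
`Suzuki2025_cor43` (the `iff`) follows from the named fact `Suzuki2025_thm42` (the screw-line
theorem under RH): `⟹` is (4.4) at `u = t` with `t₀ = 0` (`Suzuki2025_cor43_mp_of_thm42`), `⟸` is
the door `Suzuki2025_cor43_mpr`. So the only undischarged content of Cor 4.3 is the RH-CONSEQUENCE
Thm 4.2 (⟸ Prop 4.1, boundary F2). [cite: Suzuki2025WeilHilbertSpace, Cor. 4.3, proof TeX l.1260–1268] -/
theorem Suzuki2025_cor43_of_thm42 (h42 : Suzuki2025_thm42) : Suzuki2025_cor43 :=
  ⟨fun hRH ↦ ⟨0, le_rfl, fun t _ ↦ Suzuki2025_cor43_mp_of_thm42 h42 hRH t⟩,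
    fun h ↦ Suzuki2025_cor43_mpr h⟩

/-! ## Thm 4.4 (i): the door and the reduction to the RH-consequence clause -/

/-- `∫ ψ′ = 0` for a test function `ψ` (`(Dψ)^(0) = 0`): the tree's `weilMellin_deriv` at `s = ½`.
[cite: Suzuki2025WeilHilbertSpace, §4.3 (TeX l.1303–1310: "φ = Dψ satisfies φ̂(0) = 0")] -/
theorem integral_deriv_eq_zero_of_isWeilTest {ψ : ℝ → ℂ} (hψ : IsWeilTest ψ) :
    ∫ u : ℝ, deriv ψ u = 0 := by
  have h := weilMellin_deriv hψ (1 / 2)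
  rw [sub_self, neg_zero, zero_mul, weilMellin] at h
  simpa using h

/-- **(4.10) on the diagonal, window `ℝ²`**: for `ψ ∈ C_c^∞(ℝ)`,
`⟨ψ′,ψ′⟩_{G_g} = zetaScrewForm univ ψ′ ψ′ = ⟨ψ,ψ⟩_W = weilQuadratic ψ` — the tree's
`weilQuadratic_eq_integral_zetaScrewKernel` (= [Su23, Prop 3.1], `Suzuki2023_prop31_holds`)
rewritten for the window `S = univ` of `zetaScrewForm`.
[cite: Suzuki2025WeilHilbertSpace, eq. (4.10) (TeX l.1312–1318); Suzuki2023, Prop 3.1] -/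
theorem zetaScrewForm_univ_deriv_eq_weilQuadratic {ψ : ℝ → ℂ} (hψ : IsWeilTest ψ) :
    zetaScrewForm univ (deriv ψ) (deriv ψ) = weilQuadratic ψ := by
  rw [weilQuadratic_eq_integral_zetaScrewKernel hψ, zetaScrewForm]
  simp only [Measure.restrict_univ]
  refine integral_congr_ae (Filter.Eventually.of_forall fun t ↦ ?_)
  refine integral_congr_ae (Filter.Eventually.of_forall fun u ↦ ?_)
  simp only [zetaScrewKernel_def]
  push_cast
  ring

/-- RH-FREE DOOR (line 1): **CJM Thm 4.4 (i), `⟸`**. If `‖P̂_φ‖²_{L²(ℝ)} = π⟨φ,φ⟩_{G_g}` (4.7) for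
every `φ ∈ C_c^∞(ℝ)` with `φ̂(0) = ∫φ = 0`, then the Riemann hypothesis holds. Proof as printed,
contrapositively: for `ψ ∈ C_c^∞(ℝ)` the function `φ = ψ′` is admissible, and (4.7) with (4.10)
gives `⟨ψ,ψ⟩_W = ⟨ψ′,ψ′⟩_{G_g} = π⁻¹‖P̂_{ψ′}‖² ≥ 0`, i.e. Weil positivity on `C_c^∞(ℝ)`, whence RH
by Weil's criterion (`weil_criterion_holds`; its `⟸` is the off-line-zero negativity of
[Yoshida 1992, Lemma 1] invoked in the source). WHAT THIS IS NOT: nobody has shown (4.7); it is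
RH-EQUIVALENT (Thm 4.4). [cite: Suzuki2025WeilHilbertSpace, Thm. 4.4 (i) (⇐), proof §4.3 TeX l.1303–1345] -/
theorem Suzuki2025_thm44_mpr
    (h : ∀ φ : ℝ → ℂ, IsWeilTest φ → ∫ t : ℝ, φ t = 0 →
      ((∫ x : ℝ, ‖screwPhat φ x‖ ^ 2 : ℝ) : ℂ) = Real.pi * zetaScrewForm univ φ φ) :
    RiemannHypothesis := by
  have hπ : (Real.pi : ℂ) ≠ 0 := Complex.ofReal_ne_zero.mpr Real.pi_ne_zero
  have hW : Summit.RiemannHypothesis.RiemannHypothesis.WeilPositivity := by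
    intro g hg
    have hφ : IsWeilTest (deriv g) := hg.deriv
    have h47 := h (deriv g) hφ (integral_deriv_eq_zero_of_isWeilTest hg)
    rw [zetaScrewForm_univ_deriv_eq_weilQuadratic hg] at h47
    have hq : weilQuadratic g =
        (((∫ x : ℝ, ‖screwPhat (deriv g) x‖ ^ 2) / Real.pi : ℝ) : ℂ) := by
      rw [Complex.ofReal_div, eq_div_iff hπ, mul_comm]
      exact h47.symm
    rw [hq, Complex.ofReal_re]
    exact div_nonneg (integral_nonneg fun _ ↦ by positivity) Real.pi_pos.le
  exact (show RiemannHypothesis ↔ Summit.RiemannHypothesis.RiemannHypothesis.WeilPositivity from weil_criterion_holds).mpr hW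

/-- RH-FREE REDUCTION: **CJM Thm 4.4 holds as soon as its RH-CONSEQUENCE clause does** — the named
fact `Suzuki2025_thm44` ((i) the `iff` on mean-zero test functions ∧ (ii) "if the RH is true, (4.7)
holds for all `φ ∈ C_c^∞(ℝ)`") follows from clause (ii) alone: (i) `⟹` is (ii) restricted, (i) `⟸`
is the door `Suzuki2025_thm44_mpr`. So the only undischarged content of Thm 4.4 is "RH ⟹ (4.7)"
(⟸ (3.7), Prop 4.1 and (4.9); boundary F2). [cite: Suzuki2025WeilHilbertSpace, Thm. 4.4, §4.3 TeX l.1274–1345] -/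
theorem Suzuki2025_thm44_of_onlyIf
    (h : RiemannHypothesis → ∀ φ : ℝ → ℂ, IsWeilTest φ →
      ((∫ x : ℝ, ‖screwPhat φ x‖ ^ 2 : ℝ) : ℂ) = Real.pi * zetaScrewForm univ φ φ) :
    Suzuki2025_thm44 :=
  ⟨⟨fun hRH φ hφ _ ↦ h hRH φ hφ, fun h' ↦ Suzuki2025_thm44_mpr h'⟩, h⟩

end Literature.NumberTheory.LFunctions

end
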